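import Summits.ABC.StewartYu.ArchG3Setup
import Summits.ABC.StewartYu.PadicG3TwoFunctions
import Literature.NumberTheory.Transcendental.CijsouwWaldschmidt1977Setup
import Mathlib.Analysis.Complex.CauchyIntegral
import Mathlib.Analysis.SpecialFunctions.ExpDeriv
import HarnessLib

/-!
# Cell abc-stewartyu, rung A1.L (crux r2 `ArchCoreRat`), parcel WP-L.A P-A4: the FAMILY OF ENTIRE CLASS FUNCTIONS `f_τ` of the
# archimedean Gen-3 frame — Hasse weights in `Y₀`, powers of the `b`-eliminated coefficients, real exponents; the differential
# equations, entireness, iterated derivatives, and the rational values at the integer points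

`Summits/ABC/StewartYu/ArchG3Functions.lean` — sequel to `ArchG3Setup.lean` (cell `abc-stewartyu`, seat p5-g7; tranche plan §4′ P-A4;
interface agreed with the k-step seat lp-1 g8, HOME/STATUS 2026-08-27T14:26Z/14:34Z).  Definitions (functions of the datum
`ArchG3Setup`) and theorems; no named fact.  The archimedean TWIN of `PadicG3Functions.lean` (`G3Setup.g3F`, seat p2-g4): same shape
and names with `‖·‖_p ↦ |·|`, the functions now ENTIRE on `ℂ` (no slab radius).  The family is indexed by an arbitrary type `ι`
(the frame: the unknowns `(ℓ₀, λ)`), each index carrying a `Y₀`-weight `R i ∈ ℚ[Y₀]` (the frame: Fel'dman's / Nesterenko's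
`Δ(2^{S−s}Y₀; ℓ₀, H)`) and an INTEGER exponent vector `v i : Fin n → ℤ` (the frame: the exponent RELATIVE to the base point of
the slab class).  The directional coefficients are `zγ v k = 𝔛 v k / b_{j₀} ∈ ℚ` (`ArchG3Setup.zγ`), and
`E v = Σ_k zγ v k · log α_k` (`ArchG3Setup.E_eq_sum_zγ`).

* `hw R i t₀` (the Hasse weight `Hasse_{t₀} Rᵢ` read in `ℂ[X]`), `zγpow v i t = ∏_k zγ(v i)_k^{t_k} ∈ ℚ`;
* `archTermF`, **`archF B pv τ z = Σ_{i∈B} pᵢ·(Hasse_{t₀}Rᵢ)(z)·zγpow·exp(E(vᵢ)·z)`** (Nesterenko's `f` of (4.17) for the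
  multi-order `τ = (t₀; t)`), `archΦ` (the same with the exact exponent `Lsum`, (4.7)) and the RATIONAL values
  `archφ B pv τ x = Σ pᵢ·(Hasse_{t₀}Rᵢ)(x)·zγpow·∏ⱼ αⱼ^{vᵢⱼ x}` with **`archΦ τ x = archφ τ x`** at every integer `x`
  (`archΦ_intCast`; no class condition — the generators are positive reals);
* **the differential equations** `hasDerivAt_archF`:
  `d/dz f_τ = Σ_{i : Fin (n+1)} archCoef τ i · f_{τ+eᵢ}`, `archCoef τ 0 = t₀ + 1`, `archCoef τ (k+1) = log α_k` — the shape the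
  k-step seat's setup-free `ArchG3KStepCore` consumes; `differentiable_archF` (entire), `deriv_archF`, `contDiff_archF`,
  `iteratedDeriv_archF_succ`;
* the pointwise identity behind the `f − φ` comparison: `archTermF = archTermΦ · exp(−vᵢ_{j₀}·(Λ/b_{j₀})·z)` (`archTermF_eq_mul_exp`).

WHAT THIS IS NOT: sizes on discs, the `f − φ` BOUND and the normalised jets are the sequels (`ArchG3Sizes`, `ArchG3Jets`); no Schwarz /
Hermite step (lp-1's `ArchG3KStep*`); no crux moves.

References: Yu. V. Nesterenko, LNM 1819 (2003), §3.5 (3.34), §4 (4.2), (4.7), (4.16)–(4.20); M. Waldschmidt, Acta Arith. 37 (1980) §3.4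
(the tree's `Waldschmidt1980Setup`, the archimedean model of the ODE bookkeeping).
-/

noncomputable section

open Finset Polynomial
open Literature.NumberTheory.Transcendental
open Literature.NumberTheory.Transcendental.Baker1975 (bump bump_apply sum_bump)
open Literature.NumberTheory.Transcendental.CW77.Setup (Tau tauNorm bump0 bumpj bumpτ tauNorm_bumpτ
  bumpτ_zero bumpτ_succ)
open scoped Nat

namespace Summit.ABC.StewartYu

namespace ArchG3Setup

variable (S : ArchG3Setup) {ι : Type*} (R : ι → ℚ[X]) (v : ι → Fin S.n → ℤ)

/-! ### The `Y₀`-weights (Hasse derivatives, read in `ℂ`) -/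

/-- The `Y₀`-weight polynomial `Hasse_{t₀} Rᵢ` read in `ℂ[X]`. [cite: Nesterenko2003, §3.5 (3.34)] -/
def hw (i : ι) (t₀ : ℕ) : ℂ[X] := (hasseDeriv t₀ (R i)).map (algebraMap ℚ ℂ)

/-- At an integer point the weight is the rational number `(Hasse_{t₀} Rᵢ)(x)`. [folklore] -/
theorem hw_eval_intCast (i : ι) (t₀ : ℕ) (x : ℤ) :
    (hw R i t₀).eval (x : ℂ) = (((hasseDeriv t₀ (R i)).eval (x : ℚ) : ℚ) : ℂ) := by
  unfold hw
  rw [Polynomial.eval_intCast_map, eq_ratCast]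

/-- At a rational point the weight is the rational number `(Hasse_{t₀} Rᵢ)(y)`. [folklore] -/
theorem hw_eval_ratCast (i : ι) (t₀ : ℕ) (y : ℚ) :
    (hw R i t₀).eval (y : ℂ) = (((hasseDeriv t₀ (R i)).eval y : ℚ) : ℂ) := by
  unfold hw
  rw [Polynomial.eval_map, show ((y : ℂ)) = algebraMap ℚ ℂ y from rfl, Polynomial.eval₂_at_apply, eq_ratCast]

/-- The derivative of the weight, evaluated: `(hw i t₀)'(z) = (t₀+1)·(hw i (t₀+1))(z)`. [folklore] -/
theorem eval_derivative_hw (i : ι) (t₀ : ℕ) (z : ℂ) :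
    (derivative (hw R i t₀)).eval z = ((t₀ + 1 : ℕ) : ℂ) * (hw R i (t₀ + 1)).eval z := by
  unfold hw
  rw [Polynomial.derivative_map, TwoSetup.derivative_hasseDeriv_eq]
  have e : ((t₀ + 1) • hasseDeriv (t₀ + 1) (R i)).map (algebraMap ℚ ℂ) =
      (t₀ + 1) • (hasseDeriv (t₀ + 1) (R i)).map (algebraMap ℚ ℂ) :=
    map_nsmul (Polynomial.mapRingHom (algebraMap ℚ ℂ)) (t₀ + 1) _
  rw [e, Polynomial.eval_smul, nsmul_eq_mul]

/-- `d/dz (hw i t₀)(z) = (t₀+1)·(hw i (t₀+1))(z)`. [folklore] -/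
theorem hasDerivAt_hw_eval (i : ι) (t₀ : ℕ) (z : ℂ) :
    HasDerivAt (fun w => (hw R i t₀).eval w) (((t₀ + 1 : ℕ) : ℂ) * (hw R i (t₀ + 1)).eval z) z := by
  have h := Polynomial.hasDerivAt (hw R i t₀) z
  rw [eval_derivative_hw R] at h
  exact h

/-! ### The directional monomials `∏ zγ_k^{t_k}` -/

/-- `∏_k zγ(vᵢ)_k^{t_k} ∈ ℚ` (the `t`-th power of the `b`-eliminated directional coefficients). [cite: Nesterenko2003, §4.2 (4.20)] -/
def zγpow (i : ι) (t : Fin S.n → ℕ) : ℚ := ∏ k, S.zγ (v i) k ^ t k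

/-- `zγpow i 0 = 1`. [folklore] -/
@[simp] theorem zγpow_zero (i : ι) : S.zγpow v i 0 = 1 := by
  unfold zγpow; simp

/-- `zγpow(t + e_k) = zγpow(t) · zγ_k` (in `ℚ`). [folklore] -/
theorem zγpow_bump (i : ι) (t : Fin S.n → ℕ) (k : Fin S.n) :
    S.zγpow v i (bump t k) = S.zγpow v i t * S.zγ (v i) k := by
  unfold zγpow
  simp_rw [bump_apply, pow_add, prod_mul_distrib]
  congr 1
  rw [Fintype.prod_eq_single k (fun k' hk' => by rw [if_neg hk', pow_zero]), if_pos rfl, pow_one]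

/-- `zγpow(t + e_k) = zγpow(t) · zγ_k` in `ℂ`. [folklore] -/
theorem zγpow_bump_cast (i : ι) (t : Fin S.n → ℕ) (k : Fin S.n) :
    ((S.zγpow v i (bump t k) : ℚ) : ℂ) = ((S.zγpow v i t : ℚ) : ℂ) * ((S.zγ (v i) k : ℚ) : ℂ) := by
  rw [S.zγpow_bump]; push_cast; ring

/-- A positive pivot-direction order kills the monomial: `zγpow i t = 0` if `0 < t j₀` (as `zγ j₀ = 0`). [folklore] -/
theorem zγpow_eq_zero_of_pivot_pos (i : ι) {t : Fin S.n → ℕ} (ht : 0 < t S.j₀) : S.zγpow v i t = 0 := by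
  unfold zγpow
  exact prod_eq_zero (mem_univ S.j₀) (by rw [S.zγ_eq_zero_of_𝔛_eq_zero (S.𝔛_pivot (v i))]; exact zero_pow ht.ne')

/-- `|zγpow i t| ≤ ∏_k Γ_k^{t_k}` when `|zγ(vᵢ)_k| ≤ Γ_k` (in `ℝ`). [folklore] -/
theorem abs_zγpow_le (i : ι) (t : Fin S.n → ℕ) {Γ : Fin S.n → ℝ} (hΓ : ∀ k, |(S.zγ (v i) k : ℝ)| ≤ Γ k) :
    |(S.zγpow v i t : ℝ)| ≤ ∏ k, Γ k ^ t k := by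
  unfold zγpow
  push_cast
  rw [Finset.abs_prod]
  refine prod_le_prod (fun k _ => abs_nonneg _) fun k _ => ?_
  rw [abs_pow]
  exact pow_le_pow_left₀ (abs_nonneg _) (hΓ k) _

/-! ### The exponents read in `ℂ` -/

/-- The exponent `E(vᵢ)` as a complex number. [folklore] -/
def Ec (w : Fin S.n → ℤ) : ℂ := ((S.E w : ℝ) : ℂ)

/-- The exact exponent `Lsum(vᵢ)` as a complex number. [folklore] -/
def Lc (w : Fin S.n → ℤ) : ℂ := ((S.Lsum w : ℝ) : ℂ)

/-- `Ec w = Σ_k zγ w k · log α_k` in `ℂ`. [cite: Nesterenko2003, §4.2 (4.17)] -/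
theorem Ec_eq_sum_zγ (w : Fin S.n → ℤ) : S.Ec w = ∑ k, ((S.zγ w k : ℚ) : ℂ) * ((S.lg k : ℝ) : ℂ) := by
  unfold Ec
  rw [S.E_eq_sum_zγ]
  push_cast
  rfl

/-! ### The functions -/

/-- One term of `f_τ`: `(Hasse_{t₀} Rᵢ)(z) · ∏ zγ_k^{t_k} · exp(E(vᵢ)·z)`. [cite: Nesterenko2003, §4.2 (4.17)] -/
def archTermF (i : ι) (τ : Tau S.n) (z : ℂ) : ℂ :=
  (hw R i τ.1).eval z * ((S.zγpow v i τ.2 : ℚ) : ℂ) * Complex.exp (S.Ec (v i) * z)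

/-- One term of `φ_τ`: the same with the exact exponent `Lsum`. [cite: Nesterenko2003, §4 (4.7)] -/
def archTermΦ (i : ι) (τ : Tau S.n) (z : ℂ) : ℂ :=
  (hw R i τ.1).eval z * ((S.zγpow v i τ.2 : ℚ) : ℂ) * Complex.exp (S.Lc (v i) * z)

/-- **`f_τ(z) = Σ_{i∈B} pᵢ · archTermF`** (Nesterenko's `f(ζ)` of (4.17), for every multi-order `τ`). [cite: Nesterenko2003, §4.2 (4.17)] -/
def archF (B : Finset ι) (pv : ι → ℤ) (τ : Tau S.n) (z : ℂ) : ℂ :=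
  ∑ i ∈ B, (pv i : ℂ) * S.archTermF R v i τ z

/-- **`φ_τ(z) = Σ_{i∈B} pᵢ · archTermΦ`** (Nesterenko's `Φ_s(ζ, m)` of (4.7)). [cite: Nesterenko2003, §4 (4.7)] -/
def archΦ (B : Finset ι) (pv : ι → ℤ) (τ : Tau S.n) (z : ℂ) : ℂ :=
  ∑ i ∈ B, (pv i : ℂ) * S.archTermΦ R v i τ z

/-- **The rational value `φ_τ(x)`** at an integer point: `Σ pᵢ · (Hasse_{t₀}Rᵢ)(x) · zγpow · ∏ⱼ αⱼ^{vᵢⱼ x}` (the frame's native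
identity is `archφ τ x = 0`). [cite: Nesterenko2003, §4 (4.6)–(4.7)] -/
def archφ (B : Finset ι) (pv : ι → ℤ) (τ : Tau S.n) (x : ℤ) : ℚ :=
  ∑ i ∈ B, (pv i : ℚ) * (hasseDeriv τ.1 (R i)).eval (x : ℚ) * S.zγpow v i τ.2 * ∏ j, S.α j ^ (v i j * x)

/-! ### The differential equations -/

/-- **The derivative of one term**: `d/dz archTermF_τ = (t₀+1)·archTermF_{τ+e₀} + Σ_k log α_k · archTermF_{τ+e_k}`, everywhere.
[cite: Nesterenko2003, §4.2 (4.20)] -/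
theorem hasDerivAt_archTermF (i : ι) (τ : Tau S.n) (z : ℂ) :
    HasDerivAt (S.archTermF R v i τ)
      (((τ.1 + 1 : ℕ) : ℂ) * S.archTermF R v i (bump0 τ) z +
        ∑ k : Fin S.n, ((S.lg k : ℝ) : ℂ) * S.archTermF R v i (bumpj τ k) z) z := by
  have h1 := hasDerivAt_hw_eval R i τ.1 z
  have hexp : HasDerivAt (fun w => Complex.exp (S.Ec (v i) * w)) (S.Ec (v i) * Complex.exp (S.Ec (v i) * z)) z := by
    have h := ((hasDerivAt_id z).const_mul (S.Ec (v i))).cexp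
    simpa [mul_comm] using h
  have h2 : HasDerivAt (fun w => ((S.zγpow v i τ.2 : ℚ) : ℂ) * Complex.exp (S.Ec (v i) * w))
      (((S.zγpow v i τ.2 : ℚ) : ℂ) * (S.Ec (v i) * Complex.exp (S.Ec (v i) * z))) z :=
    hexp.const_mul _
  have hsplit : S.archTermF R v i τ =
      fun w => (hw R i τ.1).eval w * (((S.zγpow v i τ.2 : ℚ) : ℂ) * Complex.exp (S.Ec (v i) * w)) := by
    funext w; simp only [archTermF]; ring
  rw [hsplit]
  refine (h1.mul h2).congr_deriv ?_
  have er : ∀ k : Fin S.n, ((S.lg k : ℝ) : ℂ) * S.archTermF R v i (bumpj τ k) z =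
      (hw R i τ.1).eval z * (((S.zγpow v i τ.2 : ℚ) : ℂ) * Complex.exp (S.Ec (v i) * z)) *
        (((S.zγ (v i) k : ℚ) : ℂ) * ((S.lg k : ℝ) : ℂ)) := by
    intro k
    simp only [archTermF, bumpj]
    rw [S.zγpow_bump_cast]
    ring
  simp_rw [er]
  rw [← mul_sum, ← S.Ec_eq_sum_zγ]
  simp only [archTermF, bump0]
  ring

/-- The coefficients of the differential equation at `τ`: `t₀ + 1` in the `Y₀`-direction, `log α_k` in direction `k`.
[cite: Nesterenko2003, §4.2 (4.20)] -/
def archCoef (τ : Tau S.n) (i : Fin (S.n + 1)) : ℂ :=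
  Fin.cases (((τ.1 + 1 : ℕ) : ℂ)) (fun k => ((S.lg k : ℝ) : ℂ)) i

/-- `archCoef τ 0 = t₀ + 1`. [folklore] -/
@[simp] theorem archCoef_zero (τ : Tau S.n) : S.archCoef τ 0 = ((τ.1 + 1 : ℕ) : ℂ) := rfl

/-- `archCoef τ (k+1) = log α_k`. [folklore] -/
@[simp] theorem archCoef_succ (τ : Tau S.n) (k : Fin S.n) : S.archCoef τ k.succ = ((S.lg k : ℝ) : ℂ) := rfl

/-- `‖archCoef τ 0‖ = t₀ + 1`. [folklore] -/
theorem norm_archCoef_zero (τ : Tau S.n) : ‖S.archCoef τ 0‖ = (τ.1 : ℝ) + 1 := by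
  rw [S.archCoef_zero, Complex.norm_natCast]; push_cast; ring

/-- `‖archCoef τ (k+1)‖ = |log α_k|`. [folklore] -/
theorem norm_archCoef_succ (τ : Tau S.n) (k : Fin S.n) : ‖S.archCoef τ k.succ‖ = |S.lg k| := by
  rw [S.archCoef_succ, Complex.norm_real, Real.norm_eq_abs]

/-- **`Σᵢ ‖archCoef τ i‖ ≤ (t₀ + 1) + Σ_k A_k`** when `|log α_k| ≤ A_k` (the crude coefficient size; the affordable bookkeeping is the
normalised majorant of `ArchG3Jets`). [folklore] -/
theorem sum_norm_archCoef_le (τ : Tau S.n) {A : Fin S.n → ℝ} (hA : ∀ k, |S.lg k| ≤ A k) :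
    ∑ i, ‖S.archCoef τ i‖ ≤ ((τ.1 : ℝ) + 1) + ∑ k, A k := by
  rw [Fin.sum_univ_succ, S.norm_archCoef_zero]
  refine add_le_add le_rfl (sum_le_sum fun k _ => ?_)
  rw [S.norm_archCoef_succ]
  exact hA k

/-- **`d/dz f_τ = Σᵢ archCoef τ i · f_{τ+eᵢ}`** at every `z ∈ ℂ`. [cite: Nesterenko2003, §4.2 (4.20)] -/
theorem hasDerivAt_archF (B : Finset ι) (pv : ι → ℤ) (τ : Tau S.n) (z : ℂ) :
    HasDerivAt (S.archF R v B pv τ) (∑ i : Fin (S.n + 1), S.archCoef τ i * S.archF R v B pv (bumpτ τ i) z) z := by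
  unfold archF
  have h := HasDerivAt.fun_sum fun i (_ : i ∈ B) => (S.hasDerivAt_archTermF R v i τ z).const_mul (pv i : ℂ)
  refine h.congr_deriv ?_
  have h0 : S.archCoef τ 0 = ((τ.1 + 1 : ℕ) : ℂ) := rfl
  have hs : ∀ k : Fin S.n, S.archCoef τ k.succ = ((S.lg k : ℝ) : ℂ) := fun k => rfl
  simp only [Fin.sum_univ_succ, h0, hs, bumpτ_zero, bumpτ_succ, mul_add, sum_add_distrib, mul_sum]
  congr 1
  · exact sum_congr rfl fun i _ => by ring
  · rw [sum_comm]
    exact sum_congr rfl fun k _ => sum_congr rfl fun i _ => by ring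

/-- **`f_τ` is entire.** [folklore] -/
theorem differentiable_archF (B : Finset ι) (pv : ι → ℤ) (τ : Tau S.n) : Differentiable ℂ (S.archF R v B pv τ) :=
  fun z => (S.hasDerivAt_archF R v B pv τ z).differentiableAt

/-- `deriv f_τ = Σᵢ archCoef τ i · f_{τ+eᵢ}` (as functions). [cite: Nesterenko2003, §4.2 (4.20)] -/
theorem deriv_archF (B : Finset ι) (pv : ι → ℤ) (τ : Tau S.n) :
    deriv (S.archF R v B pv τ) = fun z => ∑ i : Fin (S.n + 1), S.archCoef τ i * S.archF R v B pv (bumpτ τ i) z :=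
  funext fun z => (S.hasDerivAt_archF R v B pv τ z).deriv

/-- `f_τ` is smooth. [folklore] -/
theorem contDiff_archF (B : Finset ι) (pv : ι → ℤ) (τ : Tau S.n) {m : WithTop ℕ∞} : ContDiff ℂ m (S.archF R v B pv τ) :=
  (S.differentiable_archF R v B pv τ).contDiff.of_le le_top

/-- **The iterated derivatives**: `f_τ^{(k+1)} = Σᵢ archCoef τ i · f_{τ+eᵢ}^{(k)}` (as functions on `ℂ`).
[cite: Nesterenko2003, §4.2 (4.20)] [cite: CijsouwWaldschmidt1977, §4 (11) (p. 189)] -/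
theorem iteratedDeriv_archF_succ (B : Finset ι) (pv : ι → ℤ) (τ : Tau S.n) (k : ℕ) :
    iteratedDeriv (k + 1) (S.archF R v B pv τ) =
      fun z => ∑ i : Fin (S.n + 1), S.archCoef τ i * iteratedDeriv k (S.archF R v B pv (bumpτ τ i)) z := by
  rw [iteratedDeriv_succ', S.deriv_archF R v B pv τ]
  funext z
  rw [iteratedDeriv_fun_sum fun i _ => (contDiff_const.mul (S.contDiff_archF R v B pv (bumpτ τ i))).contDiffAt]
  refine sum_congr rfl fun i _ => ?_
  exact iteratedDeriv_const_mul _ (S.contDiff_archF R v B pv (bumpτ τ i)).contDiffAt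

/-- Every iterated derivative of `f_τ` is entire. [folklore] -/
theorem differentiable_iteratedDeriv_archF (B : Finset ι) (pv : ι → ℤ) (τ : Tau S.n) (k : ℕ) :
    Differentiable ℂ (iteratedDeriv k (S.archF R v B pv τ)) :=
  ((S.contDiff_archF R v B pv τ (m := ⊤)).differentiable_iteratedDeriv k (WithTop.coe_lt_top (k : ℕ∞)))

/-- **The crude control of derivatives by values** (archimedean loss `Cs^k`): if `‖f_τ'(a)‖ ≤ ε` whenever `|τ'| ≤ N` and
`Σᵢ ‖archCoef τ' i‖ ≤ Cs` whenever `|τ'| ≤ N`, then `‖f_τ^{(k)}(a)‖ ≤ Cs^k · ε` whenever `|τ| + k ≤ N`.  (Affordable only when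
`log Cs ≪ log(eB)`; the general frame uses the normalised majorant of `ArchG3Jets`.) [cite: Waldschmidt1980, Lemma 3.5 (p. 270)] -/
theorem norm_iteratedDeriv_archF_le_of_forall (B : Finset ι) (pv : ι → ℤ) (a : ℂ) (N : ℕ) {ε Cs : ℝ} (hε0 : 0 ≤ ε)
    (hCs : ∀ τ : Tau S.n, tauNorm τ ≤ N → ∑ i, ‖S.archCoef τ i‖ ≤ Cs)
    (hε : ∀ τ : Tau S.n, tauNorm τ ≤ N → ‖S.archF R v B pv τ a‖ ≤ ε) :
    ∀ (k : ℕ) (τ : Tau S.n), tauNorm τ + k ≤ N → ‖iteratedDeriv k (S.archF R v B pv τ) a‖ ≤ Cs ^ k * ε := by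
  intro k
  induction k with
  | zero => intro τ hτ; simpa using hε τ (by simpa using hτ)
  | succ k ih =>
    intro τ hτ
    have hτN : tauNorm τ ≤ N := by omega
    have hCs0 : 0 ≤ Cs := (sum_nonneg fun i _ => norm_nonneg _).trans (hCs τ hτN)
    rw [S.iteratedDeriv_archF_succ R v B pv τ k]
    calc ‖∑ i : Fin (S.n + 1), S.archCoef τ i * iteratedDeriv k (S.archF R v B pv (bumpτ τ i)) a‖
        ≤ ∑ i : Fin (S.n + 1), ‖S.archCoef τ i‖ * ‖iteratedDeriv k (S.archF R v B pv (bumpτ τ i)) a‖ :=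
          (norm_sum_le _ _).trans (sum_le_sum fun i _ => (norm_mul_le _ _))
      _ ≤ ∑ i : Fin (S.n + 1), ‖S.archCoef τ i‖ * (Cs ^ k * ε) := by
          refine sum_le_sum fun i _ => mul_le_mul_of_nonneg_left (ih _ ?_) (norm_nonneg _)
          rw [tauNorm_bumpτ]; omega
      _ = (∑ i : Fin (S.n + 1), ‖S.archCoef τ i‖) * (Cs ^ k * ε) := by rw [sum_mul]
      _ ≤ Cs * (Cs ^ k * ε) := mul_le_mul_of_nonneg_right (hCs τ hτN) (by positivity)
      _ = Cs ^ (k + 1) * ε := by ring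

/-! ### The values at the integer points -/

/-- `exp (Lsum(w)·x) = ∏ⱼ αⱼ^{wⱼ x}` in `ℂ`, for an integer `x`. [cite: Nesterenko2003, §4 (4.6)–(4.7)] -/
theorem exp_Lc_mul_intCast (w : Fin S.n → ℤ) (x : ℤ) :
    Complex.exp (S.Lc w * (x : ℂ)) = (((∏ j, S.α j ^ (w j * x) : ℚ)) : ℂ) := by
  unfold Lc
  have h : S.Lc w * (x : ℂ) = (((x : ℝ) * S.Lsum w : ℝ) : ℂ) := by unfold Lc; push_cast; ring
  rw [show S.Lc w = ((S.Lsum w : ℝ) : ℂ) from rfl] at h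
  rw [h, ← Complex.ofReal_exp, S.exp_intCast_mul_Lsum, Complex.ofReal_ratCast]

/-- One term of `φ_τ` at an integer point is the rational value, cast. [folklore] -/
theorem archTermΦ_intCast (i : ι) (τ : Tau S.n) (x : ℤ) :
    S.archTermΦ R v i τ (x : ℂ) =
      (((hasseDeriv τ.1 (R i)).eval (x : ℚ) * S.zγpow v i τ.2 * ∏ j, S.α j ^ (v i j * x) : ℚ) : ℂ) := by
  unfold archTermΦ
  rw [hw_eval_intCast, S.exp_Lc_mul_intCast]
  push_cast
  ring

/-- **`φ_τ(x) = archφ τ x`** (cast) at every integer `x` — no class condition is needed over `ℝ`. [cite: Nesterenko2003, §4 (4.6)–(4.7)] -/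
theorem archΦ_intCast (B : Finset ι) (pv : ι → ℤ) (τ : Tau S.n) (x : ℤ) :
    S.archΦ R v B pv τ (x : ℂ) = ((S.archφ R v B pv τ x : ℚ) : ℂ) := by
  unfold archΦ archφ
  push_cast
  refine sum_congr rfl fun i _ => ?_
  rw [S.archTermΦ_intCast R v i τ x]
  push_cast
  ring

/-- A positive pivot-direction order kills the value: `archφ τ x = 0` if `0 < τ.2 j₀`. [folklore] -/
theorem archφ_eq_zero_of_pivot_pos (B : Finset ι) (pv : ι → ℤ) {τ : Tau S.n} (hτ : 0 < τ.2 S.j₀) (x : ℤ) :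
    S.archφ R v B pv τ x = 0 :=
  sum_eq_zero fun i _ => by rw [S.zγpow_eq_zero_of_pivot_pos v i hτ]; ring

/-- Likewise `f_τ ≡ 0` if `0 < τ.2 j₀`. [folklore] -/
theorem archF_eq_zero_of_pivot_pos (B : Finset ι) (pv : ι → ℤ) {τ : Tau S.n} (hτ : 0 < τ.2 S.j₀) (z : ℂ) :
    S.archF R v B pv τ z = 0 :=
  sum_eq_zero fun i _ => by simp only [archTermF]; rw [S.zγpow_eq_zero_of_pivot_pos v i hτ]; push_cast; ring

/-! ### The perturbation identity behind the `f − φ` comparison -/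

/-- The perturbation exponent of the index `i`: `δᵢ = −vᵢ_{j₀} · Λ / b_{j₀}` (real), so that `E(vᵢ) = Lsum(vᵢ) + δᵢ`.
[cite: Nesterenko2003, §4.2 (4.15)–(4.16)] -/
def pert (w : Fin S.n → ℤ) : ℝ := -((w S.j₀ : ℝ) * (S.Λ / (S.b S.j₀ : ℝ)))

/-- `E w = Lsum w + pert w`. [cite: Nesterenko2003, §4.2 (4.16)] -/
theorem E_eq_Lsum_add_pert (w : Fin S.n → ℤ) : S.E w = S.Lsum w + S.pert w := by
  have h := S.E_sub_Lsum w
  unfold pert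
  linarith

/-- `|pert w| = |w_{j₀}|·|Λ / b_{j₀}|`. [folklore] -/
theorem abs_pert (w : Fin S.n → ℤ) : |S.pert w| = |(w S.j₀ : ℝ)| * |S.Λ / (S.b S.j₀ : ℝ)| := by
  unfold pert; rw [abs_neg, abs_mul]

/-- **`archTermF i τ z = archTermΦ i τ z · exp(δᵢ z)`.** [cite: Nesterenko2003, §4.2 (4.16)] -/
theorem archTermF_eq_mul_exp (i : ι) (τ : Tau S.n) (z : ℂ) :
    S.archTermF R v i τ z = S.archTermΦ R v i τ z * Complex.exp (((S.pert (v i) : ℝ) : ℂ) * z) := by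
  simp only [archTermF, archTermΦ, Ec, Lc]
  rw [S.E_eq_Lsum_add_pert]
  push_cast
  rw [add_mul, Complex.exp_add]
  ring

/-- **`f_τ(z) − φ_τ(z) = Σᵢ pᵢ · archTermΦ i τ z · (exp(δᵢ z) − 1)`.** [cite: Nesterenko2003, §4.2 (4.16)] -/
theorem archF_sub_archΦ (B : Finset ι) (pv : ι → ℤ) (τ : Tau S.n) (z : ℂ) :
    S.archF R v B pv τ z - S.archΦ R v B pv τ z =
      ∑ i ∈ B, (pv i : ℂ) * S.archTermΦ R v i τ z * (Complex.exp (((S.pert (v i) : ℝ) : ℂ) * z) - 1) := by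
  unfold archF archΦ
  rw [← sum_sub_distrib]
  refine sum_congr rfl fun i _ => ?_
  rw [S.archTermF_eq_mul_exp]
  ring

end ArchG3Setup

end Summit.ABC.StewartYu

end
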